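import Summits.MatrixMultiplication.OmegaCensus.STPP222CubeFrom46

/-!
# ω-census, small pattern `(2,1,1)¹⁰`: DOMINATION CORE of the `T1` order law at `k = 10`, part F (kernel)

Cell `pub-omega`, ω construction census, seat pub-omega ENG2 (gen 36). HONEST FRAMING (verbatim): lottery ticket; floor =
certified bounds/negative ranges.  Census STRUCTURE bookkeeping (row B5, column `T1` at `k = 10`; conjecture C10 (c″) cyclic-last); nothing here
bears on `ω`: small patterns in small groups bound no exponent.

Data for `STPPSmallPatternT1K10OrderLaw.lean` (generic seed bridge, threshold `70`, exponents `≤ 69`): for the exponents `E` treated in this part, every sub-multiset of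
the cap multiset (the 28 prime powers `≤ 69` dividing `E`, caps 2 ↦ 7, 4 ↦ 4, 8 ↦ 3, 3 ↦ 4, 5 ↦ 3, 7 ↦ 3, else `2`) with product `≥ 70` dominates one of
the 96 dom-minimal seed types (each a `decide +kernel`; exponents with many capped multisets are split by the multiplicity of their smallest
prime power and re-assembled; Python replica `seeds.py 70 69` 0 exceptions).  No law is claimed in this file.
References: H. Cohn, R. Kleinberg, B. Szegedy, C. Umans, FOCS 2005 (arXiv:math/0511460), Def. 5.1.  Seat pub-omega ENG2 (gen 36), 2026-08-29.
-/

namespace Summit.MatrixMultiplication.OmegaCensus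

set_option maxHeartbeats 2000000 in
/-- Domination core at `E = 64`, piece `j = 6` copies of `2` (kernel; 540 capped multisets). -/
theorem hostCore211K10N70_E64_j6 : ∀ m ∈ subMS ([(4, 4), (8, 3), (16, 2), (32, 2), (64, 2)] : List (ℕ × ℕ)), 70 ≤ (Multiset.replicate 6 2 + m).prod →
    ∃ s ∈ ([[3, 3, 2, 2, 2], [4, 3, 3, 2], [8, 3, 3], [9, 2, 2, 2], [9, 4, 2], [5, 5, 3], [19, 2, 2], [5, 2, 2, 2, 2], [5, 4, 2, 2], [5, 4, 4], [8, 5, 2], [3, 3, 3, 3], [9, 3, 3], [9, 9], [27, 3], [7, 3, 2, 2], [11, 2, 2, 2], [11, 4, 2], [5, 3, 3, 2], [23, 2, 2], [3, 2, 2, 2, 2, 2], [4, 3, 2, 2, 2], [4, 4, 3, 2], [8, 3, 2, 2], [8, 4, 3], [16, 3, 2], [7, 7, 2], [11, 3, 3], [5, 5, 2, 2], [5, 5, 4], [25, 2, 2], [13, 2, 2, 2], [13, 4, 2], [3, 3, 3, 2, 2], [4, 3, 3, 3], [9, 3, 2, 2], [9, 4, 3], [27, 2, 2], [7, 2, 2,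 2, 2], [7, 4, 2, 2], [7, 4, 4], [8, 7, 2], [29, 2, 2], [13, 3, 3], [5, 3, 2, 2, 2], [5, 4, 3, 2], [11, 11], [31, 2, 2], [5, 5, 5], [25, 5], [7, 3, 3, 2], [2, 2, 2, 2, 2, 2, 2], [4, 2, 2, 2, 2, 2], [4, 4, 2, 2, 2], [4, 4, 4, 2], [8, 2, 2, 2, 2], [8, 4, 2, 2], [8, 4, 4], [8, 8, 2], [16, 2, 2, 2], [16, 4, 2], [16, 8], [32, 2, 2], [32, 4], [64, 2], [11, 3, 2, 2], [5, 3, 3, 3], [9, 5, 3], [17, 2, 2, 2], [17, 4, 2], [7, 7, 3], [17, 3, 3], [13, 13], [19, 3, 3], [7, 5, 5], [7, 3, 3, 3], [9, 7, 3], [23, 3, 3], [7, 7, 5], [11, 5, 5], [17, 17], [13, 5, 5], [7, 7, 7], [49, 7], [19, 19], [23, 23], [29, 29], [31, 31], [37, 37], [41, 41], [43, 43], [47, 47], [53, 53], [59, 59], [61, 61], [67, 67]] : List (List ℕ)), dom s (Multiset.replicate 6 2 + m) = true := by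
  decide +kernel

end Summit.MatrixMultiplication.OmegaCensus
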